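import Mathlib
import Summits.ValiantsHypothesis.ValiantsHypothesis.Theorems.BarrierLeverDefinableEquationsPartialDerivativeWallOrderOneBinomial

/-!
# Route BarrierLever — method wall #1c, part 1 (preliminaries): generators of the shifted
# partials of ANY order `k` and shift `τ`, the universal ceiling, and the witness
# `W_{k,e} = Σ_{j<k} (Σ_i x_i^{e+j+1})^k` (crux `DefinableEquations` stmt-8745 / item
# `SingleSizeEquations` stmt-8749; val-np-p5 g13)

Parts #1a/#1b of the chart (val-np-p5 g10–g12: `…PartialDerivativeWall*.lean`) wall the method
of shifted partial derivatives (tree `shiftedPartialsRank K k τ`: the dimension of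
`⟨x^β ∂^γ g : deg β = τ, deg γ = k⟩`) at ORDER ONE (every shift) and at SHIFT ZERO (every order
`≤ ⌊n/2⌋`) inside the open rung `SmallCircuits ℂ n 2`.  This part and the next two close EVERY
FIXED CELL `(k, τ)`: for `n ≥ max(k(τ + 2k), (2k+2)²)` the cheap polynomial
`W_{k,e} = Σ_{j<k} (Σ_i x_i^{e+j+1})^k` (`e = τ + k`; `k` consecutive power sums raised to the
`k`-th power; fan-in-two size `≤ 2k·n·(⌊log₂ n⌋ + 1)`) attains the universal ceiling
`rank g_{(k,·)[τ]} ≤ #{deg-k γ} · #{deg-τ β} = C(n+k-1,k)·C(n+τ-1,τ)`, so no order-`k` shift-`τ`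
threshold separates the class from anything (`…AllOrders.lean`, `…AllOrdersWall.lean`).

This file: (§1) the iterated partial of a monomial,
`∂^γ(a x^m) = (∏_i (m_i)_{γ_i}) a x^{m-γ}` (`iterPDeriv_monomial`, falling factorials
`Nat.descFactorial`, `γ = dirCount l` the multiplicity vector of the list of directions);
(§2) canonical direction lists, the generators `gen k τ g (γ, β) = x^β ∂^{dirList γ} g` indexed by
`GenIdx n k τ` = (deg-`k` exponent vectors) × (deg-`τ` exponent vectors), the universal ceiling
`shiftedPartialsRank_le_card_mul_card` (every shifted partial is a generator, `iterPDeriv_perm`)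
and its converse `shiftedPartialsRank_eq_of_linearIndependent`; (§3) the witness
(`powerSumPowers K n k e = Σ_{j<k} expand (e+j+1) (Σ_i x_i)^k`), the expansion
`x^β ∂^γ P(x^E) = Σ_{c ∈ supp P} coeff_c(P) · Π_E(c,γ) · x^{β + (E•c - γ)}` with the
falling-factorial weight `Π_E(c,γ) = ∏_i (c_i E)_{γ_i}` (`ffWeight`, `gen_expand_eq_sum`),
positivity of multinomial coefficients (`coeff_linPow_ne_zero`); (§4) the ROW POLYNOMIAL
`Q_γ(Y) = ∏_i (γ*_i Y)(γ*_i Y - 1)⋯(γ*_i Y - γ_i + 1)` in a formal level `Y`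
(`rowPoly`, via Mathlib's `descPochhammer`): `Q_γ(E) = Π_E(γ*, γ)`, `deg Q_γ ≤ deg γ`,
`Q_γ(0) = 0` for `γ ≠ 0`, and `Q_γ(1) = ∏ (γ*_i)_{γ_i}` — zero unless `γ = γ*`; and two
exponent-vector facts.

Honest scope: bookkeeping for a METHOD WALL; nothing here bears on the crux (b = 2 OPEN,
Chatterjee–Tengse arXiv:2309.07612 §1.3 dir. 2) or on `VP ≠ VNP`.  Definitions are explicit
polynomials / index gadgets (no `Prop`-valued facts); standard axioms.
Refs: Landsberg 2017 §6.2.2 (flattenings); Efremenko–Landsberg–Schenck–Weyman 2018 §1.1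
(shifted partials); Bürgisser 2000 §2.1 (cost model).
-/

-- `Summit.ValiantsHypothesis.ValiantsHypothesis.…` repeats a component by the D-0017 layout
-- (single-conjunct summit), which the `dupNamespace` linter flags; the name is mandated.
set_option linter.dupNamespace false

noncomputable section

namespace Summit.ValiantsHypothesis.ValiantsHypothesis.Theorems.BarrierLeverDefinableEquations

open MvPolynomial
open Literature.Computability.AlgebraicComplexity
open Literature.Barriers.ValiantsHypothesis
open scoped BigOperators

namespace PartialDerivativeWall

section Prelims

variable {K : Type*} [Field K] {n : ℕ}

/-! ## §1 Iterated partials of a monomial: falling factorials -/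

/-- The exponent vector (multiplicity count) of a list of differentiation directions. [folklore] -/
def dirCount (l : List (Fin n)) : Fin n →₀ ℕ := Multiset.toFinsupp (l : Multiset (Fin n))

/-- `dirCount (i :: l) = e_i + dirCount l`. [folklore] -/
theorem dirCount_cons (i : Fin n) (l : List (Fin n)) :
    dirCount (i :: l) = Finsupp.single i 1 + dirCount l := by
  unfold dirCount
  rw [← Multiset.cons_coe, ← Multiset.singleton_add, Multiset.toFinsupp_add,
    Multiset.toFinsupp_singleton]

/-- `dirCount [] = 0`. [folklore] -/
@[simp] theorem dirCount_nil : dirCount ([] : List (Fin n)) = 0 := by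
  unfold dirCount
  simp [Multiset.toFinsupp_zero]

/-- The degree of `dirCount l` is the length of `l`. [folklore] -/
theorem degree_dirCount (l : List (Fin n)) : (dirCount l).degree = l.length := by
  induction l with
  | nil => simp
  | cons i l ih => rw [dirCount_cons, map_add, Finsupp.degree_single, ih]; simp [add_comm]

/-- **Iterated partial derivative of a monomial**: `∂^γ (a·x^m) = (∏_i (m_i)_{γ_i}) · a · x^{m-γ}`
with falling factorials `(m)_g = m(m-1)⋯(m-g+1)` (`Nat.descFactorial`), `γ = dirCount l`.
[folklore] -/
theorem iterPDeriv_monomial (l : List (Fin n)) (m : Fin n →₀ ℕ) (a : K) :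
    iterPDeriv l (monomial m a) =
      monomial (m - dirCount l) (a * ∏ i : Fin n, ((m i).descFactorial (dirCount l i) : K)) := by
  classical
  induction l with
  | nil => simp
  | cons i l ih =>
    rw [iterPDeriv_cons, ih, pderiv_monomial, dirCount_cons]
    congr 1
    · rw [add_comm, tsub_tsub]
    · -- the coefficient: split off the factor at `j = i`
      rw [← Finset.mul_prod_erase Finset.univ (fun j => ((m j).descFactorial (dirCount l j) : K))
          (Finset.mem_univ i),
        ← Finset.mul_prod_erase Finset.univ
          (fun j => ((m j).descFactorial ((Finsupp.single i 1 + dirCount l : Fin n →₀ ℕ) j) : K))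
          (Finset.mem_univ i)]
      have hi : ((Finsupp.single i 1 + dirCount l : Fin n →₀ ℕ) i) = dirCount l i + 1 := by
        rw [Finsupp.add_apply, Finsupp.single_eq_same, add_comm]
      have hrest : ∀ j ∈ (Finset.univ : Finset (Fin n)).erase i,
          ((m j).descFactorial ((Finsupp.single i 1 + dirCount l : Fin n →₀ ℕ) j) : K) =
            ((m j).descFactorial (dirCount l j) : K) := by
        intro j hj
        rw [Finsupp.add_apply, Finsupp.single_eq_of_ne (Finset.ne_of_mem_erase hj), zero_add]
      rw [Finset.prod_congr rfl hrest, hi, Nat.descFactorial_succ, Nat.cast_mul, Finsupp.tsub_apply]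
      ring

/-! ## §2 Canonical differentiation lists and the universal ceiling at order `k`, shift `τ` -/

/-- A canonical list of directions with multiplicity vector `γ`. [folklore] -/
def dirList (γ : Fin n →₀ ℕ) : List (Fin n) := (Finsupp.toMultiset γ).toList

/-- `dirCount (dirList γ) = γ`. [folklore] -/
@[simp] theorem dirCount_dirList (γ : Fin n →₀ ℕ) : dirCount (dirList γ) = γ := by
  unfold dirCount dirList
  rw [Multiset.coe_toList, Finsupp.toMultiset_toFinsupp]

/-- `dirList γ` has length `deg γ`. [folklore] -/
theorem length_dirList (γ : Fin n →₀ ℕ) : (dirList γ).length = γ.degree := by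
  rw [← degree_dirCount, dirCount_dirList]

/-- Every list is a permutation of the canonical list of its multiplicity vector. [folklore] -/
theorem perm_dirList_dirCount (l : List (Fin n)) : l.Perm (dirList (dirCount l)) := by
  unfold dirList dirCount
  rw [← Multiset.coe_eq_coe, Multiset.coe_toList, Multiset.toFinsupp_toMultiset]

/-- Index set of the generators: pairs `(γ, β)` of exponent vectors of degrees `k` and `τ`.
[folklore] -/
abbrev GenIdx (n k τ : ℕ) : Type :=
  ↥((Finset.univ : Finset (Fin n)).finsuppAntidiag k) × ↥((Finset.univ : Finset (Fin n)).finsuppAntidiag τ)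

/-- The generators `x^β ∂^γ g`, `deg γ = k`, `deg β = τ`, indexed by pairs of exponent vectors.
[cite: EfremenkoLandsbergSchenckWeyman2018, §1.1] -/
def gen (k τ : ℕ) (g : MvPolynomial (Fin n) K)
    (p : ↥((Finset.univ : Finset (Fin n)).finsuppAntidiag k) ×
      ↥((Finset.univ : Finset (Fin n)).finsuppAntidiag τ)) : MvPolynomial (Fin n) K :=
  monomial (p.2 : Fin n →₀ ℕ) 1 * iterPDeriv (dirList (p.1 : Fin n →₀ ℕ)) g

/-- Each generator is a shifted partial of order `k`, shift `τ`. [folklore] -/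
theorem gen_mem_shiftedPartials (k τ : ℕ) (g : MvPolynomial (Fin n) K)
    (p : ↥((Finset.univ : Finset (Fin n)).finsuppAntidiag k) ×
      ↥((Finset.univ : Finset (Fin n)).finsuppAntidiag τ)) :
    gen k τ g p ∈ shiftedPartials k τ g := by
  refine ⟨dirList (p.1 : Fin n →₀ ℕ), (p.2 : Fin n →₀ ℕ), ?_,
    (degree_eq_iff_mem_finsuppAntidiag _ τ).mpr p.2.2, rfl⟩
  rw [length_dirList]
  exact (degree_eq_iff_mem_finsuppAntidiag _ k).mpr p.1.2

/-- Conversely every shifted partial of order `k`, shift `τ` is one of the generators (the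
iterated derivative depends only on the multiset of directions, `iterPDeriv_perm`). [folklore] -/
theorem shiftedPartials_subset_range_gen (k τ : ℕ) (g : MvPolynomial (Fin n) K) :
    shiftedPartials k τ g ⊆ Set.range (gen k τ g) := by
  classical
  rintro _ ⟨l, β, hl, hβ, rfl⟩
  have hk : dirCount l ∈ (Finset.univ : Finset (Fin n)).finsuppAntidiag k := by
    rw [← degree_eq_iff_mem_finsuppAntidiag, degree_dirCount, hl]
  refine ⟨⟨⟨dirCount l, hk⟩, ⟨β, (degree_eq_iff_mem_finsuppAntidiag β τ).mp hβ⟩⟩, ?_⟩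
  simp only [gen]
  rw [iterPDeriv_perm (perm_dirList_dirCount l) g]

/-- **Universal ceiling**: `rank g_{(k,·)[τ]} ≤ #{deg-k exponent vectors} · #{deg-τ monomials}`
(`= C(n+k-1,k) · C(n+τ-1,τ)`) for EVERY polynomial `g` in `n` variables.
[cite: LandsbergGCT2017, §6.2.2 (p. 158)] -/
theorem shiftedPartialsRank_le_card_mul_card (k τ : ℕ) (g : MvPolynomial (Fin n) K) :
    shiftedPartialsRank K k τ g ≤
      ((Finset.univ : Finset (Fin n)).finsuppAntidiag k).card *
        ((Finset.univ : Finset (Fin n)).finsuppAntidiag τ).card := by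
  classical
  haveI : Module.Finite K (Submodule.span K (Set.range (gen k τ g))) :=
    Module.Finite.span_of_finite K (Set.finite_range _)
  unfold shiftedPartialsRank
  calc Module.finrank K (Submodule.span K (shiftedPartials k τ g))
      ≤ Module.finrank K (Submodule.span K (Set.range (gen k τ g))) :=
        Submodule.finrank_mono (Submodule.span_mono (shiftedPartials_subset_range_gen k τ g))
    _ ≤ Fintype.card (↥((Finset.univ : Finset (Fin n)).finsuppAntidiag k) ×
          ↥((Finset.univ : Finset (Fin n)).finsuppAntidiag τ)) := finrank_range_le_card _
    _ = _ := by rw [Fintype.card_prod, Fintype.card_coe, Fintype.card_coe]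

/-- If the generators of `W` are linearly independent then `W` attains the ceiling. [folklore] -/
theorem shiftedPartialsRank_eq_of_linearIndependent {k τ : ℕ} {W : MvPolynomial (Fin n) K}
    (hli : LinearIndependent K (gen k τ W)) :
    shiftedPartialsRank K k τ W =
      ((Finset.univ : Finset (Fin n)).finsuppAntidiag k).card *
        ((Finset.univ : Finset (Fin n)).finsuppAntidiag τ).card := by
  classical
  refine le_antisymm (shiftedPartialsRank_le_card_mul_card k τ W) ?_
  haveI := finite_span_shiftedPartials (K := K) k τ W
  have hsub : Set.range (gen k τ W) ⊆ shiftedPartials k τ W := by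
    rintro _ ⟨p, rfl⟩; exact gen_mem_shiftedPartials k τ W p
  unfold shiftedPartialsRank
  calc ((Finset.univ : Finset (Fin n)).finsuppAntidiag k).card *
        ((Finset.univ : Finset (Fin n)).finsuppAntidiag τ).card
      = Fintype.card (↥((Finset.univ : Finset (Fin n)).finsuppAntidiag k) ×
          ↥((Finset.univ : Finset (Fin n)).finsuppAntidiag τ)) := by
        rw [Fintype.card_prod, Fintype.card_coe, Fintype.card_coe]
    _ = Module.finrank K (Submodule.span K (Set.range (gen k τ W))) := (finrank_span_eq_card hli).symm
    _ ≤ Module.finrank K (Submodule.span K (shiftedPartials k τ W)) :=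
        Submodule.finrank_mono (Submodule.span_mono hsub)


/-! ## §3 The witness `W_{k,e} = Σ_{j<k} (Σ_i x_i^{e+j+1})^k` and its coefficients -/

/-- The base form `(x_1 + ⋯ + x_n)^k`. [folklore] -/
def linPow (K : Type*) [Field K] (n k : ℕ) : MvPolynomial (Fin n) K := (∑ i : Fin n, X i) ^ k

/-- **The witness**: `W_{k,e} = Σ_{j<k} (Σ_i x_i^{e+j+1})^k`, i.e. the `k`-th powers of the
power sums of the `k` consecutive exponents `e+1, …, e+k` (`expand E` substitutes `x_i ↦ x_i^E`).
[folklore] -/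
def powerSumPowers (K : Type*) [Field K] (n k e : ℕ) : MvPolynomial (Fin n) K :=
  ∑ j : Fin k, expand (e + j + 1) (linPow K n k)

/-- `expand E P = Σ_{c ∈ supp P} coeff_c(P) · x^{E•c}`. [folklore] -/
theorem expand_eq_sum_monomial (E : ℕ) (P : MvPolynomial (Fin n) K) :
    expand E P = ∑ c ∈ P.support, monomial (E • c) (coeff c P) := by
  conv_lhs => rw [P.as_sum]
  rw [map_sum]
  simp_rw [expand_monomial]

/-- The base form is homogeneous of degree `k`: its monomials have degree `k`. [folklore] -/
theorem degree_eq_of_mem_support_linPow {k : ℕ} {c : Fin n →₀ ℕ}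
    (hc : c ∈ (linPow K n k).support) : c.degree = k := by
  have hP : (linPow K n k).IsHomogeneous k := by
    have h1 : (∑ i : Fin n, (X i : MvPolynomial (Fin n) K)).IsHomogeneous 1 :=
      IsHomogeneous.sum _ _ _ fun i _ => isHomogeneous_X K i
    have h2 := h1.pow k
    rw [one_mul] at h2
    exact h2
  rw [Finsupp.degree_eq_weight_one]
  exact hP (mem_support_iff.mp hc)

/-- Multinomial coefficients are positive: every degree-`k` monomial occurs in `(Σ_i x_i)^k`
(over `ℕ`). [folklore] -/
theorem coeff_linPow_nat_pos (k : ℕ) : ∀ γ : Fin n →₀ ℕ, γ.degree = k →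
    0 < coeff γ ((∑ i : Fin n, X i : MvPolynomial (Fin n) ℕ) ^ k) := by
  classical
  induction k with
  | zero =>
    intro γ hγ
    rw [Finsupp.degree_eq_zero_iff] at hγ
    subst hγ
    simp
  | succ k ih =>
    intro γ hγ
    have hne : γ ≠ 0 := by rintro rfl; simp at hγ
    obtain ⟨i, hi⟩ : ∃ i, γ i ≠ 0 := by
      by_contra h
      push Not at h
      exact hne (Finsupp.ext h)
    rw [pow_succ, Finset.mul_sum, coeff_sum]
    refine lt_of_lt_of_le ?_ (Finset.single_le_sum (fun j _ => Nat.zero_le _) (Finset.mem_univ i))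
    rw [coeff_mul_X', if_pos (Finsupp.mem_support_iff.mpr hi)]
    apply ih
    have h1 : γ - Finsupp.single i 1 + Finsupp.single i 1 = γ :=
      tsub_add_cancel_of_le (Finsupp.single_le_iff.mpr (Nat.one_le_iff_ne_zero.mpr hi))
    have h2 := congrArg Finsupp.degree h1
    rw [map_add, Finsupp.degree_single, hγ] at h2
    omega

/-- Multinomial coefficients are nonzero in characteristic `0`: `coeff_γ (Σ_i x_i)^k ≠ 0` for
`deg γ = k`. [folklore] -/
theorem coeff_linPow_ne_zero [CharZero K] {k : ℕ} {γ : Fin n →₀ ℕ} (hγ : γ.degree = k) :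
    coeff γ (linPow K n k) ≠ 0 := by
  have hmap : linPow K n k = map (Nat.castRingHom K) ((∑ i : Fin n, X i : MvPolynomial (Fin n) ℕ) ^ k) := by
    simp [linPow, map_pow, map_sum, map_X]
  rw [hmap, coeff_map]
  exact Nat.cast_ne_zero.mpr (coeff_linPow_nat_pos k γ hγ).ne'

/-- The falling-factorial weight `Π_E(c, γ) = ∏_i (c_i E)_{γ_i}` of the generator `x^β ∂^γ`
against the monomial `x^{E•c}`. [folklore] -/
def ffWeight (K : Type*) [Field K] (E : ℕ) (c γ : Fin n →₀ ℕ) : K :=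
  ∏ i : Fin n, ((c i * E).descFactorial (γ i) : K)

/-- `Π_E(c, γ) ≠ 0` forces `γ ≤ E • c`. [folklore] -/
theorem le_smul_of_ffWeight_ne_zero [CharZero K] {E : ℕ} {c γ : Fin n →₀ ℕ}
    (h : ffWeight K E c γ ≠ 0) : γ ≤ E • c := by
  intro i
  rw [Finsupp.smul_apply, smul_eq_mul, mul_comm]
  by_contra hlt
  apply h
  apply Finset.prod_eq_zero (Finset.mem_univ i)
  exact_mod_cast Nat.descFactorial_eq_zero_iff_lt.mpr (not_le.mp hlt)

/-- A generator applied to one level: `x^β ∂^γ (P(x^{E}))` as a sum of monomials. [folklore] -/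
theorem gen_expand_eq_sum (E : ℕ) (β γ : Fin n →₀ ℕ) (P : MvPolynomial (Fin n) K) :
    monomial β (1 : K) * iterPDeriv (dirList γ) (expand E P) =
      ∑ c ∈ P.support, monomial (β + (E • c - γ)) (coeff c P * ffWeight K E c γ) := by
  classical
  rw [expand_eq_sum_monomial, iterPDeriv_sum, Finset.mul_sum]
  refine Finset.sum_congr rfl fun c _ => ?_
  rw [iterPDeriv_monomial, dirCount_dirList, monomial_mul, one_mul]
  congr 2
  unfold ffWeight
  refine Finset.prod_congr rfl fun i _ => ?_
  rw [Finsupp.smul_apply, smul_eq_mul, mul_comm]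

/-! ## §4 Row polynomials in a formal level; two exponent-vector facts -/

/-- Coordinates of a degree-`d` exponent vector are at most `d`. [folklore] -/
theorem apply_le_of_degree_eq {d : ℕ} {f : Fin n →₀ ℕ} (hf : f.degree = d) (i : Fin n) : f i ≤ d :=
  hf ▸ Finsupp.le_degree i f

/-- Two distinct exponent vectors of the same degree: some coordinate of the second exceeds the
first. [folklore] -/
theorem exists_apply_lt_of_ne {γ γs : Fin n →₀ ℕ} (h : γ.degree = γs.degree) (hne : γ ≠ γs) :
    ∃ i, γs i < γ i := by
  by_contra hcon
  push Not at hcon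
  have hle : γ ≤ γs := fun i => hcon i
  have h1 : γ + (γs - γ) = γs := add_tsub_cancel_of_le hle
  have h2 := congrArg Finsupp.degree h1
  rw [map_add, ← h] at h2
  have h3 : (γs - γ).degree = 0 := by omega
  rw [Finsupp.degree_eq_zero_iff] at h3
  rw [h3, add_zero] at h1
  exact hne h1

/-- The row polynomial `Q_γ(Y) = ∏_i (γ*_i · Y)(γ*_i Y - 1)⋯(γ*_i Y - γ_i + 1)` in the formal
level `Y`: `Q_γ(E) = Π_E(γ*, γ)`. [folklore] -/
def rowPoly (K : Type*) [Field K] (γs γ : Fin n →₀ ℕ) : Polynomial K :=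
  ∏ i : Fin n, (descPochhammer K (γ i)).comp (Polynomial.C (γs i : K) * Polynomial.X)

/-- `Q_γ(E) = Π_E(γ*, γ)` at natural-number levels. [folklore] -/
theorem eval_rowPoly_natCast (γs γ : Fin n →₀ ℕ) (E : ℕ) :
    (rowPoly K γs γ).eval (E : K) = ffWeight K E γs γ := by
  unfold rowPoly ffWeight
  rw [Polynomial.eval_prod]
  refine Finset.prod_congr rfl fun i _ => ?_
  rw [Polynomial.eval_comp, Polynomial.eval_mul, Polynomial.eval_C, Polynomial.eval_X,
    ← Nat.cast_mul, descPochhammer_eval_eq_descFactorial]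

/-- `deg Q_γ ≤ deg γ`. [folklore] -/
theorem natDegree_rowPoly_le (γs γ : Fin n →₀ ℕ) : (rowPoly K γs γ).natDegree ≤ γ.degree := by
  unfold rowPoly
  refine (Polynomial.natDegree_prod_le _ _).trans ?_
  rw [Finsupp.degree_eq_sum]
  refine Finset.sum_le_sum fun i _ => ?_
  refine (Polynomial.natDegree_comp_le).trans ?_
  rw [descPochhammer_natDegree]
  have h : (Polynomial.C (γs i : K) * Polynomial.X).natDegree ≤ 1 :=
    (Polynomial.natDegree_C_mul_le _ _).trans Polynomial.natDegree_X_le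
  calc γ i * (Polynomial.C (γs i : K) * Polynomial.X).natDegree ≤ γ i * 1 :=
        Nat.mul_le_mul_left _ h
    _ = γ i := mul_one _

/-- `Q_γ(0) = 0` when `γ ≠ 0`. [folklore] -/
theorem eval_rowPoly_zero {γs γ : Fin n →₀ ℕ} (hγ : γ ≠ 0) : (rowPoly K γs γ).eval 0 = 0 := by
  obtain ⟨i, hi⟩ : ∃ i, γ i ≠ 0 := by
    by_contra h
    push Not at h
    exact hγ (Finsupp.ext h)
  unfold rowPoly
  rw [Polynomial.eval_prod]
  apply Finset.prod_eq_zero (Finset.mem_univ i)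
  rw [Polynomial.eval_comp, Polynomial.eval_mul, Polynomial.eval_X, mul_zero]
  exact descPochhammer_ne_zero_eval_zero K hi

/-- `Q_γ(1) = ∏_i (γ*_i)_{γ_i}`, which vanishes unless `γ = γ*` (same degree) and equals
`∏ γ*_i! ≠ 0` for `γ = γ*`. [folklore] -/
theorem eval_rowPoly_one (γs γ : Fin n →₀ ℕ) :
    (rowPoly K γs γ).eval 1 = ∏ i : Fin n, ((γs i).descFactorial (γ i) : K) := by
  have h := eval_rowPoly_natCast (K := K) γs γ 1
  rw [Nat.cast_one] at h
  rw [h]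
  unfold ffWeight
  simp_rw [mul_one]
end Prelims

end PartialDerivativeWall

end Summit.ValiantsHypothesis.ValiantsHypothesis.Theorems.BarrierLeverDefinableEquations
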